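import Literature.InformationTheory.Entropy.QuantumLeftoverHashingPurified
import Literature.Computability.QuantumComplexity.CertifiedRandomnessRestrictedAdversary
import HarnessLib

/-!
# Certified randomness (Liu et al. 2025), SM §III.E: the EXTRACTOR STEP against quantum side
# information — Definition 4 (quantum-proof strong extractor) TYPED, Lemma 5 (two-universal
# hashing) PROVED, and the extractor half of Corollary 7 (Toeplitz, (III.41)–(III.44)) PROVED
# GIVEN Theorem 3's entropy bound as a hypothesis

Topic `Computability/QuantumComplexity`, namespace
`Literature.Computability.QuantumComplexity.CertifiedRandomness` (the CR-D1 deployment paper's SM,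
sequel of `CertifiedRandomnessRestrictedAdversary.lean`, whose printed closed forms `minEntropyLB`
(Theorem 3 (III.30)/(III.35)) and `toeplitzOutputLB` (Corollary 7 (III.39)) are reused BY NAME).
Two definitions with bodies (SM Definition 4; §4: the amplification paper's SI Definition 72) and
theorems; no named fact, no `sorry`.

## Source (read on the page; held text `paper:arxiv-2503.20498`, PDF page = chunk number)

[cite: LiuEtAl2025CertifiedRandomness, SM Definition 1] (p0024 L28–31): ε_sou-soundness is
«`‖ρ_{K Isn∧Ω} − τ_K ⊗ ρ_{Isn∧Ω}‖_Tr ≤ ε_sou` (III.2), where `‖·‖_Tr` is the trace distance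
measure».
[cite: LiuEtAl2025CertifiedRandomness, SM Definition 4] (p0033 L33–40): «A function
`Ext : {0,1}ⁿ × {0,1}ˢ → {0,1}^ℓ` is a quantum-proof strong `(κ, ε_ext)`-extractor if, for any
classical quantum state `ρ_SE` … for which `H^{ε_s}_min(S|E)_ρ ≥ κ`, it holds that
`‖Ext(ρ_SE ⊗ τ_D) − τ_K ⊗ τ_D ⊗ ρ_E‖_Tr ≤ ½ε_ext + 2ε_s` (III.37), where `τ_D`, and `τ_K` are
maximally mixed state with dimension `2ˢ` and `2^ℓ` respectively and `ε_s ∈ [0, √Tr[ρ_SE]]`. The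
map `Ext` acts on the classical systems `S` and `D`. The input on system `D` is called the seed».
[cite: LiuEtAl2025CertifiedRandomness, SM Lemma 5] (p0033 L51–52): «(2-Universal Strong Extractor
[25]) There exist a quantum-proof strong `(κ, ε_ext)`-extractor
`Ext : {0,1}^{nM} × {0,1}ˢ → {0,1}^ℓ` with seed length `s = nM` and `ℓ ≤ κ − 2 log(1/ε_ext)`»
([25] = Renner's thesis / TSSR11 family).
[cite: LiuEtAl2025CertifiedRandomness, SM Corollary 7] (p0034 L2–13): «Let `ε_sou ∈ (0,1]`, and
suppose that a `(κ, ε_sou)`-quantum-proof strong extractor is used …, where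
`κ = Q_min(n−1) − log(1/ε_sou) − 2` (III.38) … Then, the protocol is ε_sou-sound. In particular, the
protocol is ε_sou-sound if a two-universal hash function (e.g., Toeplitz hashing) is utilized and
the length of the output satisfies `ℓ ≤ Q_min(n−1) − 3 log(1/ε_sou) − 2` (III.39)»; proof
(p0034 L17–47): the case `Pr[Ω]_ρ < ε_sou = 4ε_s` by the triangle inequality (III.41)
(`‖…‖_Tr ≤ ½‖ρ…‖₁ + ½‖τ ⊗ …‖₁ = Pr[Ω]_ρ < ε_sou`); otherwise Theorem 3 ⇒ (III.42)
`H^{ε_s}_min(X^M|Ĩsn)_{σ∧Ω} ≥ Q_min(n−1) − log(1/ε_s) = Q_min(n−1) − log(1/ε_sou) − 2`, and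
Definition 4 with `κ` as in (III.38) gives (III.43) `≤ ½ε_sou + 2ε_s = ε_sou` provided (III.44)
`ℓ ≤ κ − 2 log(1/ε_sou)` (Lemma 5).

[cite: LiuEtAl2025CertifiedRandomnessAmplification, SI Definition 72] (held text
`paper:arxiv-2511.03686`, p0219 L29–32; the randomness-AMPLIFICATION deployment): «A function
`Ext : {0,1}ⁿ × {0,1}ᵈ → {0,1}ᵐ` is called a strong quantum-proof `(n, k, d, m, ε_seeded)` seeded
extractor if for sources `ρ_XQ` with `H_min(X|Q)_ρ ≥ k`, we have
`‖ρ_{Ext(X,τ_D)DQ} − τ_M ⊗ τ_D ⊗ ρ_Q‖₁ ≤ ε_seeded` (VI.41), where `‖·‖₁` denotes the trace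
distance»; SI Lemma 80 (p0223 L56–58): the deployed Circulant seeded extractor (Theorem 9 of
Ref. [40]) has `m ≤ k − 2 log₂(1/ε_seeded)`.

## What is typed and proved (vocabulary = the tree's `QuantumLeftoverHash` chain)

The left side of (III.37) for a keyed family `ext : D → X → γ` with uniform seed — the trace
distance of the (seed, output)-block-diagonal operator `ρ_{ZDE} − τ_Z ⊗ τ_D ⊗ ρ_E` — is the tree's
`distFromUniform ρ univ ext = E_d ½ Σ_z ‖ρ_E^{[ext_d, z]} − |Z|⁻¹ ρ_E‖₁`
([cite: TomamichelEtAl2010, Definition 3 and eq. (12), (15)]); `H^{ε_s}_min` is the tree's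
purified-ball `smoothCondMinEntropy` (= SM (III.13)); a «classical quantum state» is a cq state
given by its conditional operators `ρ : X → Matrix e e ℂ`, allowed SUB-normalized (Corollary 7
applies Definition 4 to `σ_{∧Ω}`, `tr σ_{∧Ω} = Pr[Ω]`).
* §1 `IsQuantumProofStrongExtractor ext κ ε_ext` — SM DEFINITION 4 as a definition (universe-
  polymorphic in the side-information space), `_iff`, `.mono`.
* §2 `half_sqrt_rpow_le` (the hashing-term arithmetic of (III.44));
  **`isQuantumProofStrongExtractor_of_twoUniversal`** — SM LEMMA 5 PROVED for EVERY two-universal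
  family (counting form `#{d : ext_d x = ext_d x'}·|Z| ≤ |D|`), `|Z| = 2^ℓ`,
  `ℓ ≤ κ − 2log₂(1/ε_ext)`, from the tree's
  `QuantumLeftoverHash.distFromUniform_le_smoothCondMinEntropy` (TSSR11 Thm 6 shape with constant
  `2ε_s` — EXACTLY the `2ε_s` of (III.37)); **`toeplitz_isQuantumProofStrongExtractor`** — the
  DEPLOYED family (Toeplitz over `𝔽₂`, seed `m + n − 1` bits; SM §IV.F / main text p. 6) is a
  quantum-proof strong `(κ, ε_ext)`-extractor for `m ≤ κ − 2log₂(1/ε_ext)` output bits.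
* §3 `trNorm_of_posSemidef`; `distFromUniform_le_cqTrace` — (III.41): `Δ ≤ tr ρ`;
  **`cor7_extractorStep_toeplitz`** — COROLLARY 7 (two-universal/Toeplitz case): for a
  sub-normalized cq `σ` on `𝔽₂^N`, `ε_sou > 0`, the HYPOTHESIS
  `h3 : ε_sou ≤ tr σ → minEntropyLB Q_min n (ε_sou/4) ≤ H^{ε_sou/4}_min(σ)` (Theorem 3 in its
  printed conditional form) and `m ≤ toeplitzOutputLB Q_min n ε_sou` ⇒
  `distFromUniform σ univ Toeplitz ≤ ε_sou`.

[cite: DePortmannVidickRenner2012, Lemma 3.5] (held text `paper:arxiv-0912.5514`, chunk p0008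
L7–L44): «If `Ext : {0,1}ⁿ × {0,1}ᵈ → {0,1}ᵐ` is a quantum-proof `(k, ε)`-strong extractor, then for
any state `ρ_XE` and any `ε' > 0` with `H^{ε'}_min(X|E)_ρ ≥ k`,
`½‖ρ_{Ext(X,Y)YE} − ρ_{U_m} ⊗ ρ_Y ⊗ ρ_E‖₁ ≤ ε + 2ε'`», proved by taking «the state `ρ̃_XE` `ε'`-close
to `ρ_XE` for which `H_min(X|E)_ρ̃` reaches its maximum», the triangle inequality, monotonicity of the
trace distance under the extractor map (twice) and «the purified distance … is larger than the trace
distance».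

* §4 `IsStrongQuantumProofSeededExtractor ext k ε` — SI DEFINITION 72 (non-smooth `H_min`, no
  `2ε_s` term) as a definition; `IsQuantumProofStrongExtractor.seeded` (Def 4 ⇒ Def 72 with
  `ε_seeded = ½ε_ext`, for `ε_ext ≥ 0`); `isStrongQuantumProofSeededExtractor_of_twoUniversal`
  (every two-universal family with `m ≤ k − 2 log₂(1/ε)` — the shape of SI Lemma 80 — from the
  tree's `ε = 0` lemma `distFromUniform_le_rpow_condMinEntropy`);
  `toeplitz_isStrongQuantumProofSeededExtractor`. NOT typed: the Circulant family of SI Lemma 80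
  itself (its two-universality is not in the tree).
* §5 `IsStrongQuantumProofSeededExtractor.of_mem_smoothingBall` — DPVR12 LEMMA 3.5 in WITNESS form
  (for every `ρ̃ ∈ B^{ε'}(ρ)` with `H_min(X|E)_ρ̃ ≥ k`: `Δ(ρ) ≤ ε + 2ε'`, exactly the printed chain of
  inequalities, with `‖ρ − ρ̃‖₁ ≤ 2P ≤ 2ε'` from `cqTrNormDist_le_of_mem_smoothingBall`);
  `IsStrongQuantumProofSeededExtractor.smooth` — the printed form over the tree's
  `smoothCondMinEntropy` (a supremum) with STRICT slack `k < H^{ε'}_min(X|E)_ρ` (the printed `≥ k`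
  uses the maximiser, whose existence — compactness of the ball — is not formalized; see §6 of
  `FuchsVanDeGraaf.lean` for `B⁰ = {ρ}` only); and the packaging
  `IsStrongQuantumProofSeededExtractor.isQuantumProofStrongExtractor`: SI Def 72 at `(k, ε)` ⇒
  SM Def 4 at `(κ, 2ε)` for every `κ > k` (converse direction of §4's `.seeded`, up to that slack).

DEVIATIONS / SCOPE (honest). (i) Lemma 5 is printed as an EXISTENCE statement for the family of
[25] with seed `s = nM`; typed here as «every two-universal family is one», and instantiated for
the Toeplitz family actually deployed (seed `m + n − 1`); the Trevisan branch (Lemma 6 / (III.40) /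
(III.45)) is NOT typed. (ii) Definition 4's range `ε_s ∈ [0, √Tr ρ]` is kept in the definition;
the proofs never use it. (iii) Corollary 7 is proved for the EXTRACTOR STEP only: Theorem 3's
entropy bound enters as the hypothesis `h3` and is NOT proved here (it is the restricted-adversary
theorem, other files' custody), and the identification of `‖ρ_{KK_ext Ĩsn∧Ω} − τ_K ⊗ τ_{K_ext} ⊗
ρ_{Ĩsn∧Ω}‖_Tr` with `distFromUniform` is the block-diagonal bookkeeping recorded in
`QuantumLeftoverHashing.lean` (docstring of `distFromUniform`), not re-derived.

HONEST FRAMING. An extractor composition step with explicit constants; conditional on an entropy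
bound supplied as a hypothesis; certifies no entropy by itself and says nothing about which
adversaries the entropy theorem covers; nothing here proves or refutes any quantum-advantage claim;
BQP vs BPP untouched.
-/

noncomputable section

namespace Literature.Computability.QuantumComplexity

namespace CertifiedRandomness

open Matrix Finset
open scoped ComplexOrder MatrixOrder
open Literature.InformationTheory.Entropy
open Literature.InformationTheory.Entropy.QuantumLeftoverHash
open Literature.Computability.QuantumComplexity.CertifiedRandomnessRestrictedAdversary
  (minEntropyLB toeplitzOutputLB toeplitzOutputLB_eq)

universe u

variable {X : Type*} [Fintype X] [DecidableEq X] {D : Type*} [Fintype D] {γ : Type*} [Fintype γ]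
  [DecidableEq γ]

/-! ### §1 SM Definition 4 — quantum-proof strong extractors (typed over `distFromUniform`) -/

/-- **SM Definition 4 (quantum-proof strong `(κ, ε_ext)`-extractor).** «A function
`Ext : {0,1}ⁿ × {0,1}ˢ → {0,1}^ℓ` is a quantum-proof strong `(κ, ε_ext)`-extractor if, for any
classical-quantum state `ρ_SE` … for which `H^{ε_s}_min(S|E)_ρ ≥ κ`, it holds that
`‖Ext(ρ_SE ⊗ τ_D) − τ_K ⊗ τ_D ⊗ ρ_E‖_Tr ≤ ½ε_ext + 2ε_s` (III.37), where `τ_D, τ_K` are maximally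
mixed … and `ε_s ∈ [0, √Tr[ρ_SE]]`.» Typed for a keyed family `ext : D → X → γ` (seed `d ∈ D`
uniform, input alphabet `X`, output alphabet `γ`): the left side of (III.37) — the trace distance
`‖·‖_Tr = ½‖·‖₁` of the (seed, output)-block-diagonal operator — is the tree's
`distFromUniform ρ univ ext = E_d ½ Σ_z ‖ρ_E^{[ext_d, z]} − |Z|⁻¹ ρ_E‖₁`; `H^{ε_s}_min` is the
tree's purified-ball `smoothCondMinEntropy` (SM (III.13)); «classical-quantum state» = a cq state
given by
its conditional operators, allowed SUB-normalized (Corollary 7 applies the definition to the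
post-selected `σ_{∧Ω}`). The side-information space ranges over all finite types in universe `u`.
[cite: LiuEtAl2025CertifiedRandomness, SM Definition 4, eq. (III.37)] -/
def IsQuantumProofStrongExtractor (ext : D → X → γ) (κ εext : ℝ) : Prop :=
  ∀ (e : Type u) [Fintype e] [DecidableEq e] (ρ : X → Matrix e e ℂ), IsSubnormalizedCQ ρ →
    ∀ εs : ℝ, 0 ≤ εs → εs ≤ √(cqTrace ρ) → κ ≤ smoothCondMinEntropy εs ρ →
      distFromUniform ρ Finset.univ ext ≤ εext / 2 + 2 * εs

/-- Unfolding lemma for SM Definition 4. [cite: LiuEtAl2025CertifiedRandomness, SM Definition 4] -/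
theorem isQuantumProofStrongExtractor_iff (ext : D → X → γ) (κ εext : ℝ) :
    IsQuantumProofStrongExtractor.{u} ext κ εext ↔
      ∀ (e : Type u) [Fintype e] [DecidableEq e] (ρ : X → Matrix e e ℂ), IsSubnormalizedCQ ρ →
        ∀ εs : ℝ, 0 ≤ εs → εs ≤ √(cqTrace ρ) → κ ≤ smoothCondMinEntropy εs ρ →
          distFromUniform ρ Finset.univ ext ≤ εext / 2 + 2 * εs :=
  Iff.rfl

/-- Monotonicity in the parameters: a `(κ, ε)`-extractor is a `(κ', ε')`-extractor for `κ ≤ κ'`,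
`ε ≤ ε'`. [cite: LiuEtAl2025CertifiedRandomness, SM Definition 4] -/
theorem IsQuantumProofStrongExtractor.mono {ext : D → X → γ} {κ κ' ε ε' : ℝ}
    (h : IsQuantumProofStrongExtractor.{u} ext κ ε) (hκ : κ ≤ κ') (hε : ε ≤ ε') :
    IsQuantumProofStrongExtractor.{u} ext κ' ε' := by
  intro e _ _ ρ hρ εs hεs hεs' hH
  have := h e ρ hρ εs hεs hεs' (hκ.trans hH)
  linarith

/-! ### §2 SM Lemma 5 — two-universal hashing is a quantum-proof strong extractor -/

/-- The hashing term: `ℓ ≤ κ − 2·log₂(1/ε)` and `κ ≤ H` give `½√(2^{ℓ − H}) ≤ ½ε`.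
[cite: LiuEtAl2025CertifiedRandomness, SM Lemma 5, eq. (III.44)] -/
theorem half_sqrt_rpow_le {ℓ κ H ε : ℝ} (hε : 0 < ε) (hℓ : ℓ ≤ κ - 2 * Real.logb 2 (1 / ε))
    (hH : κ ≤ H) : 2⁻¹ * Real.sqrt ((2 : ℝ) ^ (ℓ - H)) ≤ ε / 2 := by
  have h1 : ℓ - H ≤ 2 * Real.logb 2 ε := by
    have : Real.logb 2 (1 / ε) = -Real.logb 2 ε := by rw [one_div, Real.logb_inv]
    rw [this] at hℓ; linarith
  have h2 : (2 : ℝ) ^ (ℓ - H) ≤ ε ^ 2 := by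
    calc (2 : ℝ) ^ (ℓ - H) ≤ (2 : ℝ) ^ (2 * Real.logb 2 ε) :=
          Real.rpow_le_rpow_of_exponent_le one_le_two h1
      _ = ((2 : ℝ) ^ Real.logb 2 ε) ^ 2 := by
          rw [mul_comm, Real.rpow_mul (by norm_num), Real.rpow_two]
      _ = ε ^ 2 := by rw [Real.rpow_logb two_pos (by norm_num) hε]
  have h3 : Real.sqrt ((2 : ℝ) ^ (ℓ - H)) ≤ ε := by
    calc Real.sqrt ((2 : ℝ) ^ (ℓ - H)) ≤ Real.sqrt (ε ^ 2) := Real.sqrt_le_sqrt h2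
      _ = ε := Real.sqrt_sq hε.le
  linarith

/-- **SM Lemma 5 (two-universal strong extractor), PROVED**: every two-universal family
`ext : D → X → γ` (counting form `#{d : ext_d x = ext_d x'}·|Z| ≤ |D|` for `x ≠ x'`), with
`|Z| = 2^ℓ` and `ℓ ≤ κ − 2 log₂(1/ε_ext)`, is a quantum-proof strong `(κ, ε_ext)`-extractor in the
sense of SM Definition 4 — for EVERY `ε_s ≥ 0` and every sub-normalized cq input (the printed range
`ε_s ∈ [0, √Tr ρ]` is not needed). Printed: «There exist a quantum-proof strong
`(κ, ε_ext)`-extractor … with seed length `s = nM` and `ℓ ≤ κ − 2 log(1/ε_ext)`» (for the family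
of [25]); the proof here is the tree's purified-ball leftover hash lemma
`distFromUniform_le_smoothCondMinEntropy`
([cite: TomamichelEtAl2010, Theorem 6] shape, constant `2ε_s`) + the hashing-term arithmetic.
[cite: LiuEtAl2025CertifiedRandomness, SM Lemma 5, eq. (III.44)] -/
theorem isQuantumProofStrongExtractor_of_twoUniversal [Nonempty D] [Nonempty γ] (ext : D → X → γ)
    (hU : ∀ x x', x ≠ x' →
      ((Finset.univ : Finset D).filter fun d => ext d x = ext d x').card * Fintype.card γ
        ≤ (Finset.univ : Finset D).card)
    {ℓ : ℕ} (hγ : Fintype.card γ = 2 ^ ℓ) {κ εext : ℝ} (hε : 0 < εext)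
    (hℓ : (ℓ : ℝ) ≤ κ - 2 * Real.logb 2 (1 / εext)) :
    IsQuantumProofStrongExtractor.{u} ext κ εext := by
  intro e _ _ ρ hρ εs hεs _ hH
  have h1 := distFromUniform_le_smoothCondMinEntropy hεs hρ Finset.univ_nonempty hU hγ (h := ext)
  have h2 := half_sqrt_rpow_le hε hℓ hH
  linarith

section Toeplitz

open Literature.Computability.Cryptography.LeftoverHash (toeplitz toeplitz_universal)

variable {n m : ℕ}

/-- **The deployed extractor.** Toeplitz hashing over `𝔽₂` (`m × n` Toeplitz matrices keyed by all
`y ∈ 𝔽₂^{m+n−1}`; the tree's `LeftoverHash.toeplitz`, two-universal by `toeplitz_universal`) is a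
quantum-proof strong `(κ, ε_ext)`-extractor for `m ≤ κ − 2 log₂(1/ε_ext)` output bits — SM Lemma 5
for the family actually used (main text p. 6: «Toeplitz … strong seeded extractor»; SM §IV.F; the
printed seed length `s = nM` of Lemma 5 is that of the family of [25] — the Toeplitz seed is
`m + n − 1` bits). [cite: LiuEtAl2025CertifiedRandomness, SM Lemma 5; SM §III.F]
[cite: TomamichelEtAl2010, Theorem 6 with §4.2] -/
theorem toeplitz_isQuantumProofStrongExtractor [NeZero (m + n - 1)] {κ εext : ℝ} (hε : 0 < εext)
    (hm : (m : ℝ) ≤ κ - 2 * Real.logb 2 (1 / εext)) :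
    IsQuantumProofStrongExtractor.{u}
      (fun (y : Fin (m + n - 1) → ZMod 2) (x : Fin n → ZMod 2) => (toeplitz (m := m) y).mulVec x)
      κ εext := by
  refine isQuantumProofStrongExtractor_of_twoUniversal _ (fun x x' hx => ?_) ?_ hε hm
  · exact (toeplitz_universal (m := m) hx).le.trans (by rw [Finset.card_univ])
  · rw [Fintype.card_fun, ZMod.card, Fintype.card_fin]

end Toeplitz

/-! ### §3 SM Corollary 7 — the extractor step of protocol soundness (Toeplitz case), GIVEN the
entropy bound of SM Theorem 3 as a hypothesis -/

section Cor7

variable {e : Type*} [Fintype e] [DecidableEq e]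

/-- `‖P‖₁ = tr P` for `P ⪰ 0`. [cite: LiuEtAl2025CertifiedRandomness, SM eq. (III.41) (the step
`‖ρ‖_Tr`-triangle with positive operators)] -/
theorem trNorm_of_posSemidef {P : Matrix e e ℂ} (hP : P.PosSemidef) : trNorm P = P.trace.re := by
  rw [trNorm_of_isHermitian hP.1, hP.1.trace_eq_sum_eigenvalues, Complex.re_sum]
  refine Finset.sum_congr rfl fun i _ => ?_
  rw [abs_of_nonneg (hP.eigenvalues_nonneg i)]
  simp

omit [DecidableEq X] [Fintype D] in
/-- **(III.41)**: the distance from uniform never exceeds the trace of the (sub-normalized) state,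
`E_k ½ Σ_z ‖ρ_E^{[h_k,z]} − |Z|⁻¹ρ_E‖₁ ≤ ½(Σ_z tr ρ_E^{[h_k,z]} + tr ρ_E) = tr ρ` — the printed
«in the case where `Pr[Ω]_ρ < ε_sou` … `‖ρ_{KK_ext Ĩsn∧Ω} − τ_K ⊗ τ_{K_ext} ⊗ ρ_{Ĩsn∧Ω}‖_Tr ≤
½‖ρ…‖₁ + ½‖τ ⊗ …‖₁ = Pr[Ω]_ρ < ε_sou`, and soundness is automatically guaranteed».
[cite: LiuEtAl2025CertifiedRandomness, SM Corollary 7 (proof), eq. (III.41)] -/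
theorem distFromUniform_le_cqTrace [Nonempty γ] {ρ : X → Matrix e e ℂ} (hρ : ∀ x, (ρ x).PosSemidef)
    (K : Finset D) (h : D → X → γ) : distFromUniform ρ K h ≤ cqTrace ρ := by
  have htr0 : 0 ≤ cqTrace ρ :=
    Finset.sum_nonneg fun x _ => (RCLike.nonneg_iff.mp (hρ x).trace_nonneg).1
  have hM : (cqMarginal ρ).PosSemidef := posSemidef_sum _ fun x _ => hρ x
  have htrM : (cqMarginal ρ).trace.re = cqTrace ρ := by
    rw [cqMarginal, trace_sum, Complex.re_sum]; rfl
  set c : ℝ := (Fintype.card γ : ℝ) with hc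
  have hc0 : 0 < c := Nat.cast_pos.mpr Fintype.card_pos
  have hcast : (Fintype.card γ : ℂ)⁻¹ = ((c⁻¹ : ℝ) : ℂ) := by rw [hc]; push_cast; rfl
  -- each key: Σ_z ‖A_z − c⁻¹ M‖₁ ≤ 2 tr ρ
  have hkey : ∀ k, ∑ z, trNorm (cqMap (h k) ρ z - (Fintype.card γ : ℂ)⁻¹ • cqMarginal ρ)
      ≤ 2 * cqTrace ρ := fun k => by
    have hz : ∀ z, trNorm (cqMap (h k) ρ z - (Fintype.card γ : ℂ)⁻¹ • cqMarginal ρ)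
        ≤ ((cqMap (h k) ρ z).trace).re + c⁻¹ * cqTrace ρ := fun z => by
      have hA : (cqMap (h k) ρ z).PosSemidef := posSemidef_cqMap (h k) hρ z
      have hB : (((c⁻¹ : ℝ) : ℂ) • cqMarginal ρ).IsHermitian := by
        change (((c⁻¹ : ℝ) : ℂ) • cqMarginal ρ)ᴴ = _
        rw [conjTranspose_smul, Complex.star_def, Complex.conj_ofReal, hM.1.eq]
      rw [hcast]
      calc trNorm (cqMap (h k) ρ z - ((c⁻¹ : ℝ) : ℂ) • cqMarginal ρ)
          ≤ trNorm (cqMap (h k) ρ z - 0) + trNorm (0 - ((c⁻¹ : ℝ) : ℂ) • cqMarginal ρ) :=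
            trNorm_sub_le_of_hermitian hA.1 hB (by simp)
        _ = trNorm (cqMap (h k) ρ z) + trNorm (((c⁻¹ : ℝ) : ℂ) • cqMarginal ρ) := by
            rw [sub_zero, zero_sub, trNorm_neg hB]
        _ ≤ ((cqMap (h k) ρ z).trace).re + c⁻¹ * trNorm (cqMarginal ρ) := by
            rw [trNorm_of_posSemidef hA]
            exact add_le_add le_rfl (trNorm_smul_le hM.1 (inv_nonneg.mpr hc0.le))
        _ = ((cqMap (h k) ρ z).trace).re + c⁻¹ * cqTrace ρ := by
            rw [trNorm_of_posSemidef hM, htrM]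
    calc ∑ z, trNorm (cqMap (h k) ρ z - (Fintype.card γ : ℂ)⁻¹ • cqMarginal ρ)
        ≤ ∑ z, (((cqMap (h k) ρ z).trace).re + c⁻¹ * cqTrace ρ) := Finset.sum_le_sum fun z _ => hz z
      _ = cqTrace (cqMap (h k) ρ) + c * (c⁻¹ * cqTrace ρ) := by
          rw [Finset.sum_add_distrib, Finset.sum_const, Finset.card_univ, nsmul_eq_mul, hc]; rfl
      _ = 2 * cqTrace ρ := by rw [cqTrace_cqMap, mul_inv_cancel_left₀ hc0.ne']; ring
  -- average over the keys
  unfold distFromUniform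
  rcases Nat.eq_zero_or_pos K.card with hK | hK
  · rw [hK]; simp [htr0]
  · have hK' : (0 : ℝ) < K.card := Nat.cast_pos.mpr hK
    calc (K.card : ℝ)⁻¹ * ∑ k ∈ K, 2⁻¹ *
          ∑ z, trNorm (cqMap (h k) ρ z - (Fintype.card γ : ℂ)⁻¹ • cqMarginal ρ)
        ≤ (K.card : ℝ)⁻¹ * ∑ k ∈ K, 2⁻¹ * (2 * cqTrace ρ) := by
          refine mul_le_mul_of_nonneg_left (Finset.sum_le_sum fun k _ => ?_) (inv_nonneg.mpr hK'.le)
          exact mul_le_mul_of_nonneg_left (hkey k) (by norm_num)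
      _ = cqTrace ρ := by
          rw [Finset.sum_const, nsmul_eq_mul]; field_simp

open Literature.Computability.Cryptography.LeftoverHash (toeplitz)

/-- **SM Corollary 7, the extractor step (two-universal/Toeplitz case, (III.39)/(III.41)–(III.44)),
PROVED GIVEN Theorem 3's entropy bound as a hypothesis.** Let `σ = σ_{X^M Ĩsn ∧Ω}` be the
sub-normalized cq state of the raw bits (`X = 𝔽₂^N`, `N = nM`) with quantum side information `Ĩsn`
(`tr σ = Pr[Ω]`), `ε_sou ∈ (0, 1]`, `ε_s = ε_sou/4`, and assume THEOREM 3 in its printed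
conditional form «`Pr[Ω] ≥ ε_sou ⇒ H^{ε_s}_min(X^M|Ĩsn)_{σ∧Ω} ≥ Q_min(n − 1) − log₂(1/ε_s)`»
(`minEntropyLB`, the tree's typed (III.30)/(III.35); NOT proved here — it is the
restricted-adversary entropy theorem). If the Toeplitz output length satisfies (III.39)
`ℓ ≤ Q_min(n − 1) − 3 log₂(1/ε_sou) − 2` (`toeplitzOutputLB`), then
`‖ρ_{K K_ext Ĩsn∧Ω} − τ_K ⊗ τ_{K_ext} ⊗ ρ_{Ĩsn∧Ω}‖_Tr ≤ ε_sou` in the typed form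
`distFromUniform σ univ Toeplitz ≤ ε_sou`: case `Pr[Ω] < ε_sou` by (III.41), else
(III.42)–(III.44) with `κ = Q_min(n−1) − log₂(1/ε_sou) − 2` and `½ε_sou + 2ε_s = ε_sou`.
(The printed `ε_sou ≤ 1` is not needed: `tr σ ≤ 1` already gives `ε_s ≤ √tr σ`.)
HONEST FRAMING: conditional on Theorem 3 as HYPOTHESIS `h3`; certifies no entropy; says nothing
about which adversaries Theorem 3 covers. [cite: LiuEtAl2025CertifiedRandomness, SM Corollary 7,
eqs. (III.38)–(III.39), proof (III.41)–(III.44)] -/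
theorem cor7_extractorStep_toeplitz {N m : ℕ} [NeZero (m + N - 1)]
    {σ : (Fin N → ZMod 2) → Matrix e e ℂ} (hσ : IsSubnormalizedCQ σ) {εsou : ℝ} (hε0 : 0 < εsou)
    {Qmin n : ℕ}
    (h3 : εsou ≤ cqTrace σ →
      minEntropyLB Qmin n (εsou / 4) ≤ smoothCondMinEntropy (εsou / 4) σ)
    (hℓ : (m : ℝ) ≤ toeplitzOutputLB Qmin n εsou) :
    distFromUniform σ Finset.univ
        (fun (y : Fin (m + N - 1) → ZMod 2) (x : Fin N → ZMod 2) => (toeplitz (m := m) y).mulVec x)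
      ≤ εsou := by
  by_cases htr : cqTrace σ < εsou
  · -- (III.41)
    exact (distFromUniform_le_cqTrace hσ.1 _ _).trans htr.le
  · -- (III.42)–(III.44)
    have hH := h3 (not_lt.mp htr)
    rw [toeplitzOutputLB_eq Qmin n hε0] at hℓ
    have hext := toeplitz_isQuantumProofStrongExtractor (n := N) (m := m) hε0 hℓ
    have hεs : εsou / 4 ≤ √(cqTrace σ) := by
      have h1 : εsou ≤ cqTrace σ := not_lt.mp htr
      have h2 : cqTrace σ ≤ √(cqTrace σ) := by
        have := Real.sqrt_le_sqrt hσ.2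
        rw [Real.sqrt_one] at this
        calc cqTrace σ = √(cqTrace σ) * √(cqTrace σ) :=
              (Real.mul_self_sqrt (by linarith)).symm
          _ ≤ √(cqTrace σ) * 1 := mul_le_mul_of_nonneg_left this (Real.sqrt_nonneg _)
          _ = √(cqTrace σ) := mul_one _
      linarith
    have := hext e σ hσ (εsou / 4) (by linarith) hεs hH
    linarith

end Cor7

/-! ### §4 The amplification paper's seeded-extractor definition (Liu et al. 2025b, SI
Definition 72) — the NON-smooth (`ε_s = 0`) special case, and two-universal hashing -/

section Seeded

variable {X : Type*} [Fintype X] [DecidableEq X] {D : Type*} [Fintype D] {γ : Type*} [Fintype γ]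
  [DecidableEq γ]

/-- **SI Definition 72 (strong quantum-proof `(n, k, d, m, ε_seeded)` seeded extractor)** of the
randomness-AMPLIFICATION deployment («Definition 7 of Ref. [36]» = Foreman–Wright–Edgington–
Berta–Curchod, Quantum 7, 969 (2023)): «A function `Ext : {0,1}ⁿ × {0,1}ᵈ → {0,1}ᵐ` is called a
strong quantum-proof `(n, k, d, m, ε_seeded)` seeded extractor if for sources `ρ_XQ` with
`H_min(X|Q)_ρ ≥ k`, we have `‖ρ_{Ext(X,τ_D) D Q} − τ_M ⊗ τ_D ⊗ ρ_Q‖₁ ≤ ε_seeded` (VI.41), where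
`‖·‖₁` denotes the trace distance.» Typed for a keyed family `ext : D → X → γ` exactly as SM
Definition 4 above but with the NON-smooth `H_min` (the tree's `condMinEntropy`) and no `2ε_s`
term; `n, d, m` are carried by the types (`|X| = 2ⁿ`, `|D| = 2ᵈ`, `|Z| = 2ᵐ` in the printed binary
case); sub-normalized cq sources allowed.
[cite: LiuEtAl2025CertifiedRandomnessAmplification, SI Definition 72, eq. (VI.41)] -/
def IsStrongQuantumProofSeededExtractor (ext : D → X → γ) (k εseeded : ℝ) : Prop :=
  ∀ (e : Type u) [Fintype e] [DecidableEq e] (ρ : X → Matrix e e ℂ), IsSubnormalizedCQ ρ →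
    k ≤ condMinEntropy ρ → distFromUniform ρ Finset.univ ext ≤ εseeded

omit [DecidableEq X] in
/-- Unfolding lemma for SI Definition 72.
[cite: LiuEtAl2025CertifiedRandomnessAmplification, SI Definition 72] -/
theorem isStrongQuantumProofSeededExtractor_iff (ext : D → X → γ) (k εseeded : ℝ) :
    IsStrongQuantumProofSeededExtractor.{u} ext k εseeded ↔
      ∀ (e : Type u) [Fintype e] [DecidableEq e] (ρ : X → Matrix e e ℂ), IsSubnormalizedCQ ρ →
        k ≤ condMinEntropy ρ → distFromUniform ρ Finset.univ ext ≤ εseeded :=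
  Iff.rfl

/-- A quantum-proof strong `(κ, ε_ext)`-extractor in the sense of SM Definition 4 (smooth entropy,
`½ε_ext + 2ε_s`) is a strong quantum-proof `(κ, ½ε_ext)` seeded extractor in the sense of SI
Definition 72 (take `ε_s = 0`: `H_min ≤ H⁰_min` on sub-normalized cq states with `tr ρ > 0` by the
tree's `condMinEntropy_le_smoothCondMinEntropy'`; the `tr ρ = 0` source is handled by (III.41)
`Δ ≤ tr ρ`). [cite: LiuEtAl2025CertifiedRandomnessAmplification, SI Definition 72]
[cite: LiuEtAl2025CertifiedRandomness, SM Definition 4] -/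
theorem IsQuantumProofStrongExtractor.seeded [Nonempty X] [Nonempty γ] {ext : D → X → γ}
    {κ εext : ℝ} (hε : 0 ≤ εext) (h : IsQuantumProofStrongExtractor.{u} ext κ εext) :
    IsStrongQuantumProofSeededExtractor.{u} ext κ (εext / 2) := by
  intro e _ _ ρ hρ hk
  have htr0 : 0 ≤ cqTrace ρ :=
    Finset.sum_nonneg fun x _ => (RCLike.nonneg_iff.mp (hρ.1 x).trace_nonneg).1
  rcases htr0.eq_or_lt with htr | htr
  · -- the zero source: Δ ≤ tr ρ = 0
    have := distFromUniform_le_cqTrace hρ.1 Finset.univ ext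
    rw [← htr] at this
    linarith
  · have h0 : (0 : ℝ) < √(cqTrace ρ) := Real.sqrt_pos.mpr htr
    have hmono := condMinEntropy_le_smoothCondMinEntropy' le_rfl hρ h0
    have := h e ρ hρ 0 le_rfl h0.le (hk.trans hmono)
    linarith

/-- **Two-universal hashing is a strong quantum-proof seeded extractor (SI Definition 72) with
`m ≤ k − 2 log₂(1/ε)`** — the `ε_s = 0` leftover hash lemma of the tree
(`QuantumLeftoverHash.distFromUniform_le_rpow_condMinEntropy`, [cite: TomamichelEtAl2010,
Theorem 6, eq. (17)]) in the amplification paper's vocabulary (the bound obtained is even `ε/2`).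
The DEPLOYED seeded extractor there is the Circulant family of SI Lemma 80 / Theorem 9 of Ref.
[40] (`m ≤ k − 2 log₂(1/ε_seeded)`), whose two-universality is not in the tree; Toeplitz below is
the tree's instance. [cite: LiuEtAl2025CertifiedRandomnessAmplification, SI Definition 72 and
Lemma 80 (the shape `m ≤ k − 2 log₂(1/ε_seeded)`)] -/
theorem isStrongQuantumProofSeededExtractor_of_twoUniversal [Nonempty D] [Nonempty γ]
    (ext : D → X → γ)
    (hU : ∀ x x', x ≠ x' →
      ((Finset.univ : Finset D).filter fun d => ext d x = ext d x').card * Fintype.card γ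
        ≤ (Finset.univ : Finset D).card)
    {m : ℕ} (hγ : Fintype.card γ = 2 ^ m) {k ε : ℝ} (hε : 0 < ε)
    (hm : (m : ℝ) ≤ k - 2 * Real.logb 2 (1 / ε)) :
    IsStrongQuantumProofSeededExtractor.{u} ext k ε := by
  intro e _ _ ρ hρ hk
  have h1 := distFromUniform_le_rpow_condMinEntropy hρ Finset.univ_nonempty hU hγ (h := ext)
  have h2 := half_sqrt_rpow_le hε hm hk
  linarith

open Literature.Computability.Cryptography.LeftoverHash (toeplitz toeplitz_universal) in
/-- Toeplitz hashing over `𝔽₂` (seed `m + n − 1`) is a strong quantum-proof `(n, k, m+n−1, m, ε)`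
seeded extractor for `m ≤ k − 2 log₂(1/ε)`. [cite: LiuEtAl2025CertifiedRandomnessAmplification,
SI Definition 72] [cite: TomamichelEtAl2010, Theorem 6 with §4.2] -/
theorem toeplitz_isStrongQuantumProofSeededExtractor {n m : ℕ} [NeZero (m + n - 1)] {k ε : ℝ}
    (hε : 0 < ε) (hm : (m : ℝ) ≤ k - 2 * Real.logb 2 (1 / ε)) :
    IsStrongQuantumProofSeededExtractor.{u}
      (fun (y : Fin (m + n - 1) → ZMod 2) (x : Fin n → ZMod 2) => (toeplitz (m := m) y).mulVec x)
      k ε := by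
  refine isStrongQuantumProofSeededExtractor_of_twoUniversal _ (fun x x' hx => ?_) ?_ hε hm
  · exact (toeplitz_universal (m := m) hx).le.trans (by rw [Finset.card_univ])
  · rw [Fintype.card_fun, ZMod.card, Fintype.card_fin]

end Seeded

/-! ### §5 De–Portmann–Vidick–Renner 2012, Lemma 3.5 — an extractor for `H_min ≥ k` extracts from
### every source with `H^{ε'}_min ≥ k`, error `ε + 2ε'` -/

section SmoothFromSeeded

variable {X : Type*} [Fintype X] [DecidableEq X] {D : Type*} [Fintype D] {γ : Type*} [Fintype γ]
  [DecidableEq γ]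

/-- **DPVR12 Lemma 3.5, witness form** (the printed proof, line by line): if `ext` is a strong
quantum-proof `(k, ε)` seeded extractor for (non-smooth) `H_min` (SI Definition 72) then for every
sub-normalized cq `ρ_XE` and every `ρ̃ ∈ B^{ε'}(ρ)` with `H_min(X|E)_ρ̃ ≥ k`,
`Δ(ρ) := E_d ½‖ρ_{ext_d(X)E} − τ ⊗ ρ_E‖₁ ≤ ε + 2ε'` — triangle inequality through `ρ̃`
(`distFromUniform_le_add_cqTrNormDist`: hashing and the marginal map do not increase `Σ_x‖·‖₁`)
and `‖ρ_XE − ρ̃_XE‖₁ ≤ 2P(ρ̃, ρ) ≤ 2ε'` (`cqTrNormDist_le_of_mem_smoothingBall`, the generalized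
Fuchs–van de Graaf inequality). [cite: DePortmannVidickRenner2012, Lemma 3.5 (proof)] -/
theorem IsStrongQuantumProofSeededExtractor.of_mem_smoothingBall [Nonempty γ] {ext : D → X → γ}
    {k ε : ℝ} (hExt : IsStrongQuantumProofSeededExtractor.{u} ext k ε) {e : Type u} [Fintype e]
    [DecidableEq e] {ρ σ : X → Matrix e e ℂ} (hρ : IsSubnormalizedCQ ρ) {ε' : ℝ}
    (hσ : σ ∈ smoothingBall ε' ρ) (hk : k ≤ condMinEntropy σ) :
    distFromUniform ρ Finset.univ ext ≤ ε + 2 * ε' := by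
  have h1 : distFromUniform σ Finset.univ ext ≤ ε := hExt e σ hσ.1 hk
  have h2 := distFromUniform_le_add_cqTrNormDist hρ.1 hσ.1.1 Finset.univ ext
  have h3 := cqTrNormDist_le_of_mem_smoothingBall hρ hσ
  linarith [abs_nonneg (cqTrace ρ - cqTrace σ)]

/-- **DPVR12 Lemma 3.5** over the tree's `smoothCondMinEntropy` (a supremum over the ε'-ball):
a strong quantum-proof `(k, ε)` seeded extractor satisfies `Δ(ρ) ≤ ε + 2ε'` for every
sub-normalized cq `ρ` with `k < H^{ε'}_min(X|E)_ρ`, `ε' ≥ 0`. The printed hypothesis is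
`H^{ε'}_min ≥ k` with the MAXIMISING `ρ̃`; attainment of the supremum (compactness of the ball) is
not formalized, whence the strict inequality (no other change).
[cite: DePortmannVidickRenner2012, Lemma 3.5] -/
theorem IsStrongQuantumProofSeededExtractor.smooth [Nonempty γ] {ext : D → X → γ} {k ε : ℝ}
    (hExt : IsStrongQuantumProofSeededExtractor.{u} ext k ε) {e : Type u} [Fintype e]
    [DecidableEq e] {ρ : X → Matrix e e ℂ} (hρ : IsSubnormalizedCQ ρ) {ε' : ℝ} (hε' : 0 ≤ ε')
    (hk : k < smoothCondMinEntropy ε' ρ) :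
    distFromUniform ρ Finset.univ ext ≤ ε + 2 * ε' := by
  have hne : (condMinEntropy '' smoothingBall ε' ρ).Nonempty :=
    ⟨_, ρ, self_mem_smoothingBall hε' hρ, rfl⟩
  obtain ⟨s, ⟨σ, hσ, rfl⟩, hks⟩ := exists_lt_of_lt_csSup hne hk
  exact hExt.of_mem_smoothingBall hρ hσ hks.le

/-- **SI Definition 72 ⇒ SM Definition 4, up to the attainment slack**: a strong quantum-proof
`(k, ε)` seeded extractor (non-smooth `H_min`, [cite: LiuEtAl2025CertifiedRandomnessAmplification,
SI Definition 72]) is a quantum-proof strong `(κ, 2ε)`-extractor in the sense of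
[cite: LiuEtAl2025CertifiedRandomness, SM Definition 4] (`Δ ≤ ½(2ε) + 2ε_s` whenever
`H^{ε_s}_min ≥ κ`) for every `κ > k` — the converse direction of `IsQuantumProofStrongExtractor.seeded`.
[cite: DePortmannVidickRenner2012, Lemma 3.5] -/
theorem IsStrongQuantumProofSeededExtractor.isQuantumProofStrongExtractor [Nonempty γ]
    {ext : D → X → γ} {k κ ε : ℝ} (hExt : IsStrongQuantumProofSeededExtractor.{u} ext k ε)
    (hκ : k < κ) : IsQuantumProofStrongExtractor.{u} ext κ (2 * ε) := by
  intro e _ _ ρ hρ εs hεs _ hκle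
  have := hExt.smooth hρ hεs (hκ.trans_le hκle)
  linarith

end SmoothFromSeeded

end CertifiedRandomness

end Literature.Computability.QuantumComplexity
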